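import Summits.QuantumFields.BalabanUV.T4Continuum.Support.NE7AllMinimisersFluxGradGeneric
import Summits.QuantumFields.BalabanUV.T4Continuum.Support.NE7AxialGaugePotentialHolder
import Summits.QuantumFields.BalabanUV.T4Continuum.Support.NE7HolderConstantsArith
import HarnessLib

/-!
# NE7AllMinimisersHolderRegGeneric — (9)-TYPE k-UNIFORM HÖLDER REGULARITY OF EVERY CONSTRAINED SMALL-FIELD MINIMISER, EVERY `β < 1`, `d = 4`, ANY BLOCK SIZE `L ≥ 2`,
# ANY `U(n)`:  `∀ β ∈ (0,1), ∃ a₀ a₁ a₂ ≥ 0, ∃ ε₀ > 0, ∀ 0 < ε ≤ ε₀, ∀ N ≥ 1, ∃ δ_V > 0` such that for every datum `V` of the small data of radius `δ_V`, every level `k`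
# and EVERY minimiser `U` of `sfClass 4 L N ε` at level `k` over `V`, and every site `z`:
#     `TermwiseHolder.HolderReg U z 6 ((L^k)⁻¹) (a₀ε) (a₁ε) β (a₂ε)`
# — the (D)-block letters `hA9W ∕ hB9W` of the HR tower of route #1's END (✓ p812443 ∕ p812547), whose only consumer is `HolderReg.locReg`, for OUR minimisers as a
# KERNEL FACT (the letters remain hypotheses of the END because the END quantifies over abstract backgrounds `VA VB`; their intended instances are these minimisers)

Cell `pub-balaban`, rung (B)+1 sub-cell t4, lineage `b2b-balaban-t4-ne7-p1` (CRUX PROVER NE7 #1 = OWNER of BINDER row NE7), generation 111.  Memo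
`t4/b2b-balaban-t4-ne7-p1-g111/ROAD-G111.md`.  File F5 (last) of the line (ROAD-G110 §NEXT (N2)); over F4b `NE7AxialGaugePotentialHolder.holderReg_of_classData` (the letter
for ONE configuration), F5a `NE7HolderConstantsArith` (the k-uniform constants), and the class data of our minimisers: unitary + `SmallField U (ε∕M²)` from the class itself
(`IsMinimiser.mem`), the covariant flux-gradient bound `‖∇_U F‖ ≤ C·ε·(1+k)∕M³` — the (10)-log — from ✓ `NE7ClassFluxGradBoundGeneric.exists_classFluxGradConst_generic` +
interiority ✓ p810303 + the Fermat theorem `tanCritical_of_isMinimiser` (the assembly of ✓ `all_minimisers_fluxGrad_generic`, re-run with `ε` displayed in the constant).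
THE MECHANISM (why the junction logarithm of the (10)-log does not obstruct `β < 1`): in the complete axial gauge on an `l1`-ball of FIXED radius the potential `B = log U^{v₀}`
has `‖B‖ ≲ a`, `‖ΔB‖ ≲ a + b`, `‖ΔΔB‖ ≲ b + a²` (F4∕F4b) with `a = ε∕M²`, `b = Cε(1+k)∕M³`; the Hölder clause of `HolderReg` tests LATTICE distances `h ≥ 1` only, so it costs
`h·(1+k)∕M³ ≤ c₂h^β∕M^{2+β} ⟸ (1+k) ≤ c₂M^{1−β}`, and `(1+k)·L^{−k(1−β)} ≤ (1 − L^{β−1})⁻¹` (F5a) — uniform in `k` for every `β < 1`, divergent at `β = 1` exactly as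
print's `B₄(β₀) ↑ ∞` ([Balaban1985RegularSpaces] (1.36), cell GAPS C-B8-18) and as the junction-log numerics (kit j342950, ROAD-G110 §4).
WHAT ([folklore]; 0 def, 0 sorry).  `all_minimisers_classData_explicit` (unitary, `SmallField U (ε∕M²)`, `‖∇_U F‖ ≤ Cε(1+k)∕M³`, `C = C(L, card n)` BEFORE `ε`);
**`all_minimisers_holderReg_generic`** (displayed above; `a₀ = 200`, `a₁ = 8(200C + 20001)`, `a₂ = 12(K₁(C)(2C(1 − L^{β−1})⁻¹ + 202) + 6464C + 653024)`).
HONEST FRAMING (page 1): a theorem about OUR constrained minimisers (B11 (8) with the small-field class `sfClass`) by OUR route (axial gauge + the (10)-log), NOT Bałaban's (9)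
and NOT by his method (Landau gauge, regular spaces); LATTICE-LOCAL (pairs at `l1`-distance ≤ 12 around each site, the range `HolderReg.locReg` consumes), NOT print's (9) over
physical distance ≤ 1 (which does NOT follow from the log bound); nothing of Bałaban's asserted as an axiom; the END's other displayed hypotheses (data class, rows U2∕U3's (B)(C),
the rest of (D)) untouched; NE3∕NE7 NOT proved as spine nodes (dagwriter∕referees' call); spine 0∕9; FIXED FINITE T⁴ rung (B)+1 — NOT infinite volume, NOT mass gap, NOT
BetaPertH, NOT Clay (continuum YM on T⁴ ⇐ BetaPertH ∧ nine spine estimates).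
-/

set_option autoImplicit false

open scoped BigOperators Matrix Matrix.Norms.L2Operator
open NormedSpace Finset

namespace Summit.QuantumFields.BalabanUV.T4Continuum.NE7AllMinimisersHolderRegGeneric

open Literature.MathematicalPhysics.QuantumFieldTheory.Balaban1983to89
open B7Prop1Explicit B7Prop2Explicit
open T4AveragingDeficitWall (IsUnitaryCfg IsSkewDir SmallField Ad covGrad flux)
open T4AveragingDeficitWallBoundary (IsPeriodicCfg periodBox)
open AveragingDeficitPeriodicCounting (IsPeriodicDir)
open AveragingDeficitTransport (norm_Ad_of_unitary)
open AveragingDeficitMultiLevelPrep (LevelSmall TangentIter)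
open MinimalActionSandwich (IsMinimiser admissible)
open MinimalActionRate (sfClass)
open NE3RightInverseSolveLetters (thetaLoc thetaLoc_nonneg)
open GaugeFieldPerturbation (norm_flux_le_of_smallField)
open NE7AllMinimisersSmallGeneric (all_minimisers_small_generic)
open NE7OpenOfMinimisation (tanCritical_of_isMinimiser)
open NE7ClassFluxGradBoundGeneric (exists_classFluxGradConst_generic)
open NE7EnergyClassPoincareGeneric (classPackage)
open TermwiseHolder (HolderReg)
open NE7AxialGaugePotentialHolder (holderReg_of_classData)
open NE7HolderConstantsArith (succ_mul_rpow_le holder_constants_le)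

noncomputable section

variable {n : Type} [Fintype n] [DecidableEq n]

set_option maxHeartbeats 400000 in
/-- **THE CLASS DATA OF EVERY CONSTRAINED MINIMISER, `ε` DISPLAYED**: `∃ C ≥ 0, ∃ ε₀ > 0, ∀ 0 < ε ≤ ε₀, ∀ N ≥ 1, ∃ δ_V > 0`, for every datum of the small data, every level `k`
and every minimiser `U` at level `k`: `U` is unitary, `SmallField U (ε∕(L^k)²)`, and `‖∇_U F(x; κ, π)‖ ≤ C·ε·(1+k)∕(L^k)³` (the assembly of ✓ `all_minimisers_fluxGrad_generic`
with the constant's factor `ε` displayed). [folklore] -/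
theorem all_minimisers_classData_explicit [Nonempty n] {L : ℕ} (hL : 2 ≤ L) :
    ∃ C : ℝ, 0 ≤ C ∧ ∃ ε₀ : ℝ, 0 < ε₀ ∧ ∀ ε : ℝ, 0 < ε → ε ≤ ε₀ → ∀ (N : ℕ) [NeZero N], 1 ≤ N →
      ∃ δV : ℝ, 0 < δV ∧
        ∀ V ∈ {V : Site 4 → Fin 4 → (Matrix n n ℂ)ˣ | IsUnitaryCfg V ∧ IsPeriodicCfg V (N : ℤ) ∧ SmallField V δV},
        ∀ (k : ℕ) (U : Site 4 → Fin 4 → (Matrix n n ℂ)ˣ), IsMinimiser 4 (sfClass 4 L N ε) L N k V U →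
          IsUnitaryCfg U ∧ SmallField U (ε / ((L : ℝ) ^ k) ^ 2) ∧
          ∀ (x : Site 4) (κ : Fin 4) (π : T4AveragingDeficitWall.Plane 4),
            ‖covGrad U (flux U) x κ π‖ ≤ C * ε * (1 + (k : ℝ)) / ((L : ℝ) ^ k) ^ 3 := by
  haveI : NeZero L := ⟨by omega⟩
  have hL1 : 1 ≤ L := Nat.le_trans (by norm_num) hL
  obtain ⟨ε₁, hε₁, H1⟩ := all_minimisers_small_generic (n := n) hL
  obtain ⟨C, hC, H2⟩ := exists_classFluxGradConst_generic (n := n) hL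
  obtain ⟨θ₀, CF, CE, hθ₀, -, -, -, -, -, hls, -, -⟩ := classPackage (n := n) (d := 4) (by norm_num) hL
  have hθL : 0 ≤ thetaLoc 4 L := thetaLoc_nonneg 4 L
  have hθpos : 0 < 2 * thetaLoc 4 L + 1 := by linarith
  refine ⟨C + 4, by positivity, min ε₁ (min θ₀ (min (1 / 50) (1 / (2 * thetaLoc 4 L + 1)))),
    lt_min hε₁ (lt_min hθ₀ (lt_min (by norm_num) (by positivity))), ?_⟩
  intro ε hε hεle N _ hN
  have hεε₁ : ε ≤ ε₁ := hεle.trans (min_le_left _ _)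
  have hεθ₀ : ε ≤ θ₀ := hεle.trans ((min_le_right _ _).trans (min_le_left _ _))
  have hε50 : ε ≤ 1 / 50 := hεle.trans ((min_le_right _ _).trans ((min_le_right _ _).trans (min_le_left _ _)))
  have hεθL : ε ≤ 1 / (2 * thetaLoc 4 L + 1) := hεle.trans ((min_le_right _ _).trans ((min_le_right _ _).trans (min_le_right _ _)))
  have hθline : 2 * thetaLoc 4 L * ε ≤ 1 := by
    have h1 : 2 * thetaLoc 4 L * ε ≤ 2 * thetaLoc 4 L * (1 / (2 * thetaLoc 4 L + 1)) := mul_le_mul_of_nonneg_left hεθL (by positivity)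
    have h2 : 2 * thetaLoc 4 L * (1 / (2 * thetaLoc 4 L + 1)) ≤ 1 := by
      rw [← mul_div_assoc, mul_one, div_le_one hθpos]; linarith
    exact h1.trans h2
  have hlsε : ∀ k : ℕ, LevelSmall 4 L k (ε / ((L : ℝ) ^ (k + 1)) ^ 2) := hls hε.le hεθ₀
  obtain ⟨δV, hδV, Hsmall⟩ := H1 ε hε hεε₁ N hN
  refine ⟨δV, hδV, ?_⟩
  intro V hV k U hmin
  refine ⟨hmin.mem.1.1, hmin.mem.1.2.2, ?_⟩
  rintro x κ ⟨⟨μ, ν⟩, hμν⟩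
  cases k with
  | zero =>
      have hUu : IsUnitaryCfg U := hmin.mem.1.1
      have hUx : SmallField U (ε / ((L : ℝ) ^ 0) ^ 2) := hmin.mem.1.2.2
      rw [pow_zero, one_pow, div_one] at hUx
      have hflux := norm_flux_le_of_smallField hUx (hε50.trans (by norm_num))
      have h1 : ‖covGrad U (flux U) x κ ⟨(μ, ν), hμν⟩‖ ≤ 2 * ε + 2 * ε := by
        unfold covGrad
        refine (norm_sub_le _ _).trans (add_le_add ?_ (hflux _))
        rw [norm_Ad_of_unitary (hUu x κ)]
        exact hflux _
      have e : (C + 4) * ε * (1 + ((0 : ℕ) : ℝ)) / ((L : ℝ) ^ 0) ^ 3 = C * ε + 4 * ε := by push_cast; ring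
      rw [e]
      nlinarith
  | succ j =>
      have hUa := Hsmall V hV (j + 1) U hmin
      have ha0 : 0 ≤ (ε / 4) / ((L : ℝ) ^ (j + 1)) ^ 2 := by positivity
      have haε : (ε / 4) / ((L : ℝ) ^ (j + 1)) ^ 2 < ε / ((L : ℝ) ^ (j + 1)) ^ 2 :=
        div_lt_div_of_pos_right (by linarith) (by positivity)
      have hcrit := tanCritical_of_isMinimiser (d := 4) (L := L) hL1 hN hmin ha0 haε hUa (hlsε j)
      have h := H2 N ε hε hε50 hθline hlsε V j U hmin.mem hcrit x κ μ ν hμν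
      refine h.trans (div_le_div_of_nonneg_right ?_ (by positivity))
      have hkk : (0 : ℝ) ≤ 1 + ((j + 1 : ℕ) : ℝ) := by positivity
      nlinarith [mul_nonneg hε.le hkk]

set_option maxHeartbeats 800000 in
/-- **(9)-TYPE k-UNIFORM HÖLDER REGULARITY OF EVERY CONSTRAINED SMALL-FIELD MINIMISER, EVERY `β < 1`** (statement in the file header). [folklore] -/
theorem all_minimisers_holderReg_generic [Nonempty n] {L : ℕ} (hL : 2 ≤ L) {β : ℝ} (hβ : 0 < β) (hβ1 : β < 1) :
    ∃ a₀ a₁ a₂ : ℝ, 0 ≤ a₀ ∧ 0 ≤ a₁ ∧ 0 ≤ a₂ ∧ ∃ ε₀ : ℝ, 0 < ε₀ ∧ ∀ ε : ℝ, 0 < ε → ε ≤ ε₀ → ∀ (N : ℕ) [NeZero N], 1 ≤ N →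
      ∃ δV : ℝ, 0 < δV ∧
        ∀ V ∈ {V : Site 4 → Fin 4 → (Matrix n n ℂ)ˣ | IsUnitaryCfg V ∧ IsPeriodicCfg V (N : ℤ) ∧ SmallField V δV},
        ∀ (k : ℕ) (U : Site 4 → Fin 4 → (Matrix n n ℂ)ˣ), IsMinimiser 4 (sfClass 4 L N ε) L N k V U →
          ∀ z : Site 4, HolderReg U z 6 (((L : ℝ) ^ k)⁻¹) (a₀ * ε) (a₁ * ε) β (a₂ * ε) := by
  obtain ⟨C, hC, ε₁, hε₁, H⟩ := all_minimisers_classData_explicit (n := n) hL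
  have hLr : (1 : ℝ) < L := by exact_mod_cast (lt_of_lt_of_le (by norm_num) hL)
  -- the geometric letter's constant
  set G : ℝ := (1 - (L : ℝ) ^ (β - 1))⁻¹ with hGdef
  have hG0 : 0 ≤ G := by
    have := (succ_mul_rpow_le hLr hβ1 0).1
    rw [hGdef]; exact inv_nonneg.mpr this.le
  refine ⟨200, 8 * (200 * C + 20001),
    12 * ((8 * (201 + 200 * (4 * (101 * (2 * C + 202) + 1))) + 8 * 404 ^ 2 * (2 * C + 202)) * (2 * C * G + 202) + 6464 * C + 653024),
    by norm_num, by positivity, by positivity, min ε₁ (1 / 206), lt_min hε₁ (by norm_num), ?_⟩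
  intro ε hε hεle N _ hN
  have hεε₁ : ε ≤ ε₁ := hεle.trans (min_le_left _ _)
  have hε206 : ε ≤ 1 / 206 := hεle.trans (min_le_right _ _)
  have hε1 : ε ≤ 1 := hε206.trans (by norm_num)
  obtain ⟨δV, hδV, HV⟩ := H ε hε hεε₁ N hN
  refine ⟨δV, hδV, ?_⟩
  intro V hV k U hmin z
  obtain ⟨hUu, hUs, hUg⟩ := HV V hV k U hmin
  -- the scales
  set M : ℝ := (L : ℝ) ^ k with hMdef
  have hM1 : 1 ≤ M := one_le_pow₀ hLr.le
  have hM0 : 0 < M := by linarith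
  have hkkM : 1 + (k : ℝ) ≤ M := by
    have h1 : k + 1 ≤ 2 ^ k := Nat.lt_two_pow_self
    have h2 : 2 ^ k ≤ L ^ k := Nat.pow_le_pow_left hL k
    have h3 : ((k + 1 : ℕ) : ℝ) ≤ ((L ^ k : ℕ) : ℝ) := by exact_mod_cast h1.trans h2
    rw [hMdef]; push_cast at h3 ⊢; linarith
  have ha0 : 0 ≤ ε / M ^ 2 := by positivity
  have haε : ε / M ^ 2 ≤ ε := div_le_self hε.le (one_le_pow₀ hM1)
  have ha4 : ε / M ^ 2 ≤ 1 / 4 := haε.trans (hε206.trans (by norm_num))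
  have hRa : ((100 + 3 : ℕ) : ℝ) * (ε / M ^ 2) ≤ 1 / 2 := by
    calc ((100 + 3 : ℕ) : ℝ) * (ε / M ^ 2) ≤ 103 * ε := by push_cast; nlinarith
      _ ≤ 1 / 2 := by linarith
  have hb0 : 0 ≤ C * ε * (1 + (k : ℝ)) / M ^ 3 := by positivity
  have hη : 0 < M⁻¹ := inv_pos.mpr hM0
  -- the letter for ONE configuration, at `d = 4`, `R₀ = 6`, `R = 100`
  have hreg := holderReg_of_classData (d := 4) hUu hUs ha0 ha4 hb0 hUg 6 (R := 100) (by norm_num) hRa hη hβ z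
  -- the k-uniform constants
  obtain ⟨hGpos, hG⟩ := succ_mul_rpow_le hLr hβ1 k
  obtain ⟨b0, b1, b2⟩ := holder_constants_le (C := C) (G := G) (β := β) (kk := 1 + (k : ℝ)) hε hε1 hM1 (by linarith) hkkM hC hβ1.le
    (by rw [hGdef, hMdef]; exact hG)
  refine hreg.mono hη.le ?_ ?_ ?_
  · calc (2 : ℝ) * ((100 : ℕ) : ℝ) * (ε / M ^ 2) / M⁻¹ = 200 * (ε / M ^ 2) / M⁻¹ := by push_cast; ring
      _ ≤ 200 * ε := b0
  · refine le_trans (le_of_eq ?_) b1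
    push_cast; ring
  · refine le_trans (le_of_eq ?_) b2
    push_cast; ring

end

end Summit.QuantumFields.BalabanUV.T4Continuum.NE7AllMinimisersHolderRegGeneric
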